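import Literature.AnabelianGeometry.SemiGraphs.CategoricalVocabularyNonVacuity
import Literature.AnabelianGeometry.SemiGraphs.CosetCategories
import Literature.AnabelianGeometry.SemiGraphs.QuasiTemperoidsQDPairs
import Literature.AnabelianGeometry.SemiGraphs.BObjFunctors
import Literature.AnabelianGeometry.SemiGraphs.NodNonVerticialGeometry
import Literature.AnabelianGeometry.SemiGraphs.TemperedCoveringsComponents
import Mathlib.Topology.Instances.ZMod
import Mathlib.Topology.Algebra.Constructions
import HarnessLib

/-!
# Non-vacuity of four `Hom` structures and of `PSCDatum.EndpointData` (L3 inhabitation census)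

PROOF-ONLY companion (abc-iut cell, layer L3, row «NV-L3 Hom-structure inhabitation family», abc-iut-L3-lead
gen 5 ruling α41; writer abc-iut-w6-d050).  abc-iut-w4-d098's kernel INHABITATION-CENSUS-L3 v2 lists the
morphism structures `ContHomCat.Hom` ([SemiAnbd] Prop. 3.2), `CosetCat.Hom` ([FrdII] Ex. 1.3 (i)), `QDPair.Hom`
([SemiAnbd] Def. A.3 (ii)), `SemiGraphOfAnabelioids.BObj.Hom` ([SemiAnbd] Def. 2.1 p. 23) and the datum
`PSCDatum.EndpointData` ([NodNon] Def. 1.1 (vi)) with ZERO named producers: their inhabitants so far are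
category-instance fields (`𝟙`, `≫`) or terms typed `X ⟶ Y`, which a by-name scan does not see.  This file
records NAMED witnesses TYPED WITH THE STRUCTURE NAMES — identities / canonical morphisms at every object, one
NON-identity witness each, and for `EndpointData` an honest general producer (every LOOP-FREE PSC datum) plus a
toy instance with a node — so that the census reads «inhabited» with a kernel reference.  RECON: for
`ContHomCat` the hom-sets are already treated exhaustively by abc-iut-w5-d149's
`CategoricalVocabularyNonVacuity.lean` (p422360: `ContHomCat.nonempty_hom_self`, `nonempty_hom_iff`, `isIso_hom`,
`exists_end_iff_mem_centralizer`, typed with `φ ⟶ ψ`); §1 below only re-types the identity witness BY NAME with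
`ContHomCat.Hom` and adds the explicit conjugate-object witness and one concrete non-identity arrow.  No `def`, no `instance`, no new named fact;
every statement is a `Nonempty …` / `∃ …` theorem proved by an explicit term.  Classical; nothing of
[SemiAnbd] / [NodNon] is asserted and no side is taken on [IUTchIII] Cor. 3.12.
-/

namespace Literature.AnabelianGeometry.SemiGraphs

open CategoryTheory
open scoped Pointwise

universe v₁ u₁ u

/-! ### §1 `ContHomCat.Hom` ([SemiAnbd] Prop. 3.2: morphisms `φ → ψ` = elements `g` with `γ_g ∘ φ = ψ`) -/

namespace ContHomCat

variable {G₁ : Type u} [Group G₁] [TopologicalSpace G₁] {G₂ : Type u} [Group G₂] [TopologicalSpace G₂]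

/-- Identity witness, typed with the structure name (BY NAME from abc-iut-w5-d149's
`ContHomCat.nonempty_hom_self`, p422360): `1 ∈ Π₂` is a morphism `φ → φ`. [cite: MochizukiSemiAnbd2006, Prop 3.2 p.35] -/
theorem Hom.nonempty_self (φ : ContHomCat G₁ G₂) : Nonempty (ContHomCat.Hom φ φ) :=
  ContHomCat.nonempty_hom_self φ

/-- Endomorphisms with prescribed conjugator, typed with the structure name (BY NAME from
`ContHomCat.exists_end_iff_mem_centralizer`, p422360): every `z` in the centraliser of `φ(Π₁)` is a morphism
`φ → φ` with `elt = z`. [cite: MochizukiSemiAnbd2006, Prop 3.2 p.35] -/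
theorem Hom.exists_self_elt_eq (φ : ContHomCat G₁ G₂) (z : G₂)
    (hz : z ∈ Subgroup.centralizer (Set.range φ.hom)) : ∃ f : ContHomCat.Hom φ φ, f.elt = z :=
  (ContHomCat.exists_end_iff_mem_centralizer φ z).mpr hz

/-- Non-identity witness between (in general) DISTINCT objects: for every `φ` and `g ∈ Π₂`, the conjugate
`γ_g ∘ φ : x ↦ g·φ(x)·g⁻¹` is an object and `g` is a morphism `φ → γ_g ∘ φ`.
[cite: MochizukiSemiAnbd2006, Prop 3.2 p.35] -/
theorem Hom.exists_conj [IsTopologicalGroup G₂] (φ : ContHomCat G₁ G₂) (g : G₂) :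
    ∃ (ψ : ContHomCat G₁ G₂) (f : ContHomCat.Hom φ ψ), f.elt = g ∧ ∀ x, ψ.hom x = g * φ.hom x * g⁻¹ := by
  refine ⟨⟨{
    toFun := fun x => g * φ.hom x * g⁻¹
    map_one' := (by simp)
    map_mul' := fun x y => (by simp [mul_assoc])
    continuous_toFun := (continuous_const.mul φ.hom.continuous).mul continuous_const }⟩,
    ⟨g, fun _ => rfl⟩, rfl, fun _ => rfl⟩

/-- Concrete non-identity endomorphism (universe `0`): over `Π₁ = Π₂ = ℤ/2` (discrete), the identity
homomorphism has the morphism `φ → φ` given by the non-trivial element.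
[cite: MochizukiSemiAnbd2006, Prop 3.2 p.35] -/
theorem Hom.exists_elt_ne_one :
    ∃ (φ : ContHomCat (Multiplicative (ZMod 2)) (Multiplicative (ZMod 2))) (f : ContHomCat.Hom φ φ),
      f.elt ≠ 1 :=
  ⟨⟨ContinuousMonoidHom.id _⟩, ⟨Multiplicative.ofAdd 1, fun x => mul_inv_cancel_comm _ _⟩, by decide⟩

end ContHomCat

/-! ### §2 `CosetCat.Hom` ([FrdII] Ex. 1.3 (i): `G`-equivariant maps `G/U → G/V`) -/

namespace CosetCat

variable {G : Type u} [Group G] [TopologicalSpace G]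

/-- Identity witness. [cite: MochizukiFrdII2008, Ex 1.3 (i) p.11] -/
theorem nonempty_hom_self (X : CosetCat G) : Nonempty (CosetCat.Hom X X) := ⟨𝟙 X⟩

/-- Canonical witness: the unique morphism `G/U → G/G` (`CosetCat.toTop`, a producer BY NAME typed `X ⟶ top`).
[cite: MochizukiFrdII2008, Ex 1.3 (i) p.11] -/
theorem nonempty_hom_top (X : CosetCat G) : Nonempty (CosetCat.Hom X top) := ⟨toTop X⟩

/-- Non-identity witness: for open subgroups `U ≤ V` the projection `G/U → G/V`, `g·U ↦ g·V`
(`CosetCat.homMk` at the `U`-fixed point `1·V`). [cite: MochizukiFrdII2008, Ex 1.3 (i) p.11] -/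
theorem nonempty_hom_of_le (U V : OpenSubgroup G) (h : U ≤ V) :
    Nonempty (CosetCat.Hom (⟨U⟩ : CosetCat G) ⟨V⟩) :=
  ⟨homMk ((1 : G) : (⟨V⟩ : CosetCat G).carrier) fun u hu => by
    rw [MulAction.Quotient.smul_coe, QuotientGroup.eq]
    simpa [smul_eq_mul] using h hu⟩

/-- The projection of `nonempty_hom_of_le` sends `g·U` to `g·V`. [cite: MochizukiFrdII2008, Ex 1.3 (i) p.11] -/
theorem exists_hom_of_le_toFun (U V : OpenSubgroup G) (h : U ≤ V) :
    ∃ f : CosetCat.Hom (⟨U⟩ : CosetCat G) ⟨V⟩, ∀ g : G,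
      f.toFun (g : (⟨U⟩ : CosetCat G).carrier) = (g : (⟨V⟩ : CosetCat G).carrier) :=
  ⟨homMk ((1 : G) : (⟨V⟩ : CosetCat G).carrier) fun u hu => by
      rw [MulAction.Quotient.smul_coe, QuotientGroup.eq]
      simpa [smul_eq_mul] using h hu,
    fun g => by rw [homMk_toFun_coe, MulAction.Quotient.smul_coe, smul_eq_mul, mul_one]⟩

end CosetCat

/-! ### §3 `QDPair.Hom` ([SemiAnbd] Def. A.3 (ii): `φ : A → B` with every `γ_A` descending to some `γ_B`) -/

namespace QDPair

variable {Q : Type u₁} [Category.{v₁} Q]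

/-- Identity witness. [cite: MochizukiSemiAnbd2006, Def A.3(ii) p.82] -/
theorem nonempty_hom_self (P : QDPair Q) : Nonempty (QDPair.Hom P P) := ⟨𝟙 P⟩

/-- Canonical witness: the identity of `A` is a morphism of QD-pairs `(A, Γ_A) → (A, Aut_Q(A))`.
[cite: MochizukiSemiAnbd2006, Def A.3(ii) p.82] -/
theorem nonempty_hom_top (P : QDPair Q) : Nonempty (QDPair.Hom P ⟨P.A, ⊤⟩) :=
  ⟨⟨𝟙 P.A, fun γ _ => ⟨γ, Subgroup.mem_top _, by rw [Category.id_comp, Category.comp_id]⟩⟩⟩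

/-- Non-identity witness: EVERY arrow `φ : A → B` of `Q` is a morphism of QD-pairs `(A, {1}) → (B, Γ_B)`
(the descent condition is vacuous on the trivial group). [cite: MochizukiSemiAnbd2006, Def A.3(ii) p.82] -/
theorem exists_hom_of_bot {A : Q} (P : QDPair Q) (φ : A ⟶ P.A) :
    ∃ f : QDPair.Hom ⟨A, ⊥⟩ P, f.hom = φ :=
  ⟨⟨φ, fun γ hγ => ⟨1, P.Γ.one_mem, by
    rw [Subgroup.mem_bot] at hγ
    subst hγ
    change φ ≫ (Iso.refl _).hom = (Iso.refl _).hom ≫ φ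
    rw [Iso.refl_hom, Iso.refl_hom, Category.comp_id, Category.id_comp]⟩⟩, rfl⟩

/-- Non-identity endomorphism witness: every `γ ∈ Γ_A` is (the arrow of) an endomorphism of the QD-pair
`(A, Γ_A)` — `δ ∈ Γ_A` descends to `γ δ γ⁻¹ ∈ Γ_A`. [cite: MochizukiSemiAnbd2006, Def A.3(ii) p.82] -/
theorem exists_hom_self_of_mem (P : QDPair Q) (γ : Aut P.A) (hγ : γ ∈ P.Γ) :
    ∃ f : QDPair.Hom P P, f.hom = γ.hom :=
  ⟨⟨γ.hom, fun δ hδ => ⟨γ * δ * γ⁻¹, P.Γ.mul_mem (P.Γ.mul_mem hγ hδ) (P.Γ.inv_mem hγ), by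
    change γ.hom ≫ (γ.symm ≪≫ (δ ≪≫ γ)).hom = δ.hom ≫ γ.hom
    simp⟩⟩, rfl⟩

end QDPair

/-! ### §4 `SemiGraphOfAnabelioids.BObj.Hom` ([SemiAnbd] Def. 2.1 p. 23: morphisms of `B(𝒢)`) -/

namespace SemiGraphOfAnabelioids.BObj

variable {𝒢 : SemiGraphOfAnabelioids.{v₁, u₁, u}}

/-- Identity witness. [cite: MochizukiSemiAnbd2006, Def. 2.1 p.23] -/
theorem nonempty_hom_self (A : 𝒢.BObj) : Nonempty (BObj.Hom A A) := ⟨𝟙 A⟩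

/-- Composition witness: `BObj.Hom` is closed under the category's composition.
[cite: MochizukiSemiAnbd2006, Def. 2.1 p.23] -/
theorem nonempty_hom_comp {A B C : 𝒢.BObj} (f : BObj.Hom A B) (g : BObj.Hom B C) :
    Nonempty (BObj.Hom A C) :=
  ⟨CategoryStruct.comp (X := A) (Y := B) (Z := C) f g⟩

/-- Witness from components (producer BY NAME `BObj.isoMk`, typed `A ≅ B`): vertex and edge isomorphisms
compatible with the gluings give morphisms `A → B` and `B → A`. [cite: MochizukiSemiAnbd2006, Def. 2.1 p.23] -/
theorem nonempty_hom_of_components {A B : 𝒢.BObj} (eS : ∀ v, A.S v ≅ B.S v) (eT : ∀ e, A.T e ≅ B.T e)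
    (comm : ∀ (b : 𝒢.graph.Branch) (v : 𝒢.graph.Vertex) (h : 𝒢.graph.abuts b = some v),
      (𝒢.pull b v h).pullback.map (eS v).hom ≫ (B.ψ b v h).hom =
        (A.ψ b v h).hom ≫ (eT (𝒢.graph.edgeOf b)).hom) :
    Nonempty (BObj.Hom A B) ∧ Nonempty (BObj.Hom B A) :=
  ⟨⟨(isoMk eS eT comm).hom⟩, ⟨(isoMk eS eT comm).inv⟩⟩

/-- Non-identity witness: every family of AUTOMORPHISMS of the vertex and edge objects compatible with the
gluings is an endomorphism of `A` with those components (e.g. a Galois automorphism family).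
[cite: MochizukiSemiAnbd2006, Def. 2.1 p.23] -/
theorem exists_hom_self_of_components (A : 𝒢.BObj) (eS : ∀ v, A.S v ≅ A.S v) (eT : ∀ e, A.T e ≅ A.T e)
    (comm : ∀ (b : 𝒢.graph.Branch) (v : 𝒢.graph.Vertex) (h : 𝒢.graph.abuts b = some v),
      (𝒢.pull b v h).pullback.map (eS v).hom ≫ (A.ψ b v h).hom =
        (A.ψ b v h).hom ≫ (eT (𝒢.graph.edgeOf b)).hom) :
    ∃ f : BObj.Hom A A, (∀ v, f.fS v = (eS v).hom) ∧ ∀ e, f.fT e = (eT e).hom :=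
  ⟨(isoMk eS eT comm).hom, fun _ => rfl, fun _ => rfl⟩

end SemiGraphOfAnabelioids.BObj

/-! ### §5 `PSCDatum.EndpointData` ([NodNon] Def. 1.1 (vi): end-points of the reference pro-nodes) -/

namespace PSCDatum

variable {P : Type u} [Group P] [TopologicalSpace P]

/-- **General producer (loop-free data).**  For every PSC datum whose nodes have two DISTINCT end
vertices, end-point data exist: orient each node by the vertices `v₁, v₂` of the interface axiom
`nodeGp_le`, and take `cᵢ(e) := γᵢ⁻¹` for the conjugators `γᵢ` with `γᵢ Π_e γᵢ⁻¹ ⊆ Π_{vᵢ}`; the no-loop clause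
is vacuous.  (For data WITH loops the clause `loop_ne` is the content of [NodNon] Lem. 1.8 — GAP-LEDGER
G-w4d081-1 — and is not derivable from the interface; nothing is claimed there.)
[cite: HoshiMochizukiNodNon2011, Def 1.1 (vi) p.285] -/
theorem nonempty_endpointData_of_loopless (G : PSCDatum P) (hG : ∀ e : G.graph.N, ¬ (G.graph.nodeEnds e).IsDiag) :
    Nonempty G.EndpointData := by
  classical
  choose v₁ v₂ hends h₁ h₂ using G.nodeGp_le
  choose γ₁ hγ₁ using h₁
  choose γ₂ hγ₂ using h₂
  have key : ∀ (e : G.graph.N) (γ : ConjAct P) (v : G.graph.V), γ • G.nodeGp e ≤ G.vertGp v →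
      G.nodeGp e ≤ MulAut.conj (ConjAct.ofConjAct γ)⁻¹ • G.vertGp v := by
    intro e γ v hle x hx
    rw [Subgroup.mem_pointwise_smul_iff_inv_smul_mem, map_inv, inv_inv, MulAut.smul_def, MulAut.conj_apply]
    have hx' : γ • x ∈ γ • G.nodeGp e := Subgroup.smul_mem_pointwise_smul _ _ _ hx
    rw [ConjAct.smul_def] at hx'
    exact hle hx'
  refine ⟨{
    src := v₁
    tgt := v₂
    c₁ := fun e => (ConjAct.ofConjAct (γ₁ e))⁻¹
    c₂ := fun e => (ConjAct.ofConjAct (γ₂ e))⁻¹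
    nodeEnds_eq := hends
    nodeGp_le_src := fun e => key e (γ₁ e) (v₁ e) (hγ₁ e)
    nodeGp_le_tgt := fun e => key e (γ₂ e) (v₂ e) (hγ₂ e)
    loop_ne := fun e he _ => hG e (by rw [hends e, he]; exact Sym2.mk_isDiag_iff.mpr rfl) }⟩

/-- In particular every NODE-FREE PSC datum has end-point data. [cite: HoshiMochizukiNodNon2011, Def 1.1 (vi) p.285] -/
theorem nonempty_endpointData_of_isEmpty (G : PSCDatum P) [IsEmpty G.graph.N] : Nonempty G.EndpointData :=
  G.nonempty_endpointData_of_loopless fun e => isEmptyElim e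

/-- Every topological group is pro-`Σ` for `Σ` = all primes (bookkeeping for the toy datum below). [folklore] -/
private theorem isProSigma_allPrimes (R : Type) [Group R] [TopologicalSpace R] : IsProSigma {p | p.Prime} R :=
  ⟨fun _ _ _ hp _ => hp⟩

/-- **Toy instance with a node** (universe `0`): over `ℤ/2` (discrete), the PSC datum with two vertices
`false`, `true` joined by ONE node (all constituent groups trivial, `Σ` = all primes) is loop-free, has a node,
and carries end-point data with `src = false`, `tgt = true`, `c₁ = c₂ = 1` — so `EndpointData` is inhabited at
a datum where its node fields are not vacuous. [cite: HoshiMochizukiNodNon2011, Def 1.1 (vi) p.285] -/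
theorem exists_endpointData_with_node :
    ∃ (G : PSCDatum (Multiplicative (ZMod 2))) (ε : G.EndpointData),
      Nonempty G.graph.N ∧ ∀ e, ε.src e ≠ ε.tgt e := by
  let G : PSCDatum (Multiplicative (ZMod 2)) :=
    { Sigma := {p | p.Prime}
      sigma_prime := fun _ hp => hp
      sigma_nonempty := ⟨2, Nat.prime_two⟩
      graph := { V := Bool, N := Unit, C := Empty, nodeEnds := fun _ => s(false, true), cuspEnd := nofun }
      vertGp := fun _ => ⊥
      nodeGp := fun _ => ⊥
      cuspGp := nofun
      genus := fun _ => 2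
      isClosed_vertGp := fun _ => isClosed_discrete _
      isClosed_nodeGp := fun _ => isClosed_discrete _
      isClosed_cuspGp := nofun
      nodeGp_le := fun _ => ⟨false, true, rfl, ⟨1, by rw [Subgroup.smul_bot]⟩, ⟨1, by rw [Subgroup.smul_bot]⟩⟩
      cuspGp_le := nofun
      proSigma := isProSigma_allPrimes _ }
  let ε : G.EndpointData := {
    src := fun _ => false
    tgt := fun _ => true
    c₁ := fun _ => 1
    c₂ := fun _ => 1
    nodeEnds_eq := fun _ => rfl
    nodeGp_le_src := fun _ => bot_le
    nodeGp_le_tgt := fun _ => bot_le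
    loop_ne := fun _ h => absurd h Bool.false_ne_true }
  exact ⟨G, ε, ⟨()⟩, fun _ => Bool.false_ne_true⟩

end PSCDatum

/-! ### §6 `ProfiniteSemiGraph.CovHom` ([SemiAnbd] §3 p. 36: the morphisms of `B^cov(G)`) — v2 append

abc-iut-w5-d197's INHABITATION-CENSUS-L3 v5 (09:45Z) still lists `ProfiniteSemiGraph.CovHom` with ZERO named
producers: its inhabitants in the tree are the `Category (CovObj 𝒢)` instance fields and terms typed `S ⟶ T`
(e.g. `CovObj.colorHom`), invisible to a by-name scan.  Below: the identity and composition witnesses typed BY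
NAME, the bridge from any arrow `S ⟶ T`, and one NON-identity witness at EVERY object — the canonical arrow to
the one-sheeted trivial covering `CovObj.trivialCov 𝒢 PUnit` (abc-iut-L3-t1 lineage's `CovObj.colorHom` with
the constant colouring), together with its uniqueness (so that `trivialCov 𝒢 PUnit` is weakly terminal with
subsingleton hom-sets).  No `def`, no `instance`, no new named fact. -/

namespace ProfiniteSemiGraph

variable {𝒢 : ProfiniteSemiGraph.{u}}

/-- `CovHom` is inhabited at every object of `B^cov(G)`: the identity, typed by name.
[cite: MochizukiSemiAnbd2006, §3 p.36] -/
theorem CovHom.nonempty_self (S : CovObj 𝒢) : Nonempty (CovHom S S) :=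
  ⟨𝟙 S⟩

/-- Every arrow `S ⟶ T` of the category `B^cov(G)` is a `CovHom S T` (bridge for by-name scans: all the
tree's `S ⟶ T`-valued constructions produce `CovHom`s). [cite: MochizukiSemiAnbd2006, §3 p.36] -/
theorem CovHom.nonempty_of_hom {S T : CovObj 𝒢} (f : S ⟶ T) : Nonempty (CovHom S T) :=
  ⟨f⟩

/-- `CovHom`s compose. [cite: MochizukiSemiAnbd2006, §3 p.36] -/
theorem CovHom.nonempty_comp {S T U : CovObj 𝒢} (h₁ : Nonempty (CovHom S T))
    (h₂ : Nonempty (CovHom T U)) : Nonempty (CovHom S U) := by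
  obtain ⟨f⟩ := h₁
  obtain ⟨g⟩ := h₂
  exact ⟨CategoryStruct.comp (X := S) (Y := T) (Z := U) f g⟩

/-- **A non-identity witness at every object**: the canonical morphism from any covering `S` to the
one-sheeted trivial covering (the constant colouring, which is trivially constant along adjacency).
[cite: MochizukiSemiAnbd2006, Def 3.5(i) p.37] -/
theorem CovHom.nonempty_to_trivialCov (S : CovObj 𝒢) :
    Nonempty (CovHom S (CovObj.trivialCov 𝒢 PUnit.{u + 1})) :=
  ⟨CovObj.colorHom 𝒢 PUnit.{u + 1} S (fun _ => PUnit.unit) fun _ _ _ => rfl⟩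

/-- The morphism to the one-sheeted trivial covering is unique: `CovHom S (trivialCov 𝒢 PUnit)` is a
subsingleton (all components are maps into a one-point fibre). [cite: MochizukiSemiAnbd2006, Def 3.5(i) p.37] -/
theorem CovHom.eq_of_to_trivialCov (S : CovObj 𝒢) (f g : CovHom S (CovObj.trivialCov 𝒢 PUnit.{u + 1})) :
    f = g := by
  ext v x <;> exact Subsingleton.elim (α := PUnit.{u + 1}) _ _

/-- Hence exactly one `CovHom` from every covering to the one-sheeted trivial covering.
[cite: MochizukiSemiAnbd2006, Def 3.5(i) p.37] -/
theorem CovHom.existsUnique_to_trivialCov (S : CovObj 𝒢) :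
    ∃! _ : CovHom S (CovObj.trivialCov 𝒢 PUnit.{u + 1}), True := by
  obtain ⟨f⟩ := CovHom.nonempty_to_trivialCov S
  exact ⟨f, trivial, fun g _ => CovHom.eq_of_to_trivialCov S g f⟩

/-- A witness between two DISTINCT named objects: the `X`-sheeted trivial covering maps to the one-sheeted
one. [cite: MochizukiSemiAnbd2006, Def 3.5(i) p.37] -/
theorem CovHom.nonempty_trivialCov_to_trivialCov_punit (X : Type u) [Countable X] :
    Nonempty (CovHom (CovObj.trivialCov 𝒢 X) (CovObj.trivialCov 𝒢 PUnit.{u + 1})) :=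
  CovHom.nonempty_to_trivialCov _

end ProfiniteSemiGraph

end Literature.AnabelianGeometry.SemiGraphs
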